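import Summits.CriticalPhenomena.SAWScalingLimit.Theorems.LeftRightFKG.Negative.PAKitDefs
import HarnessLib

/-!
# Negative knowledge on crux `LeftRightFKG`, part 15: `PAKit` soundness I — the `TP₂` block inequality, the
class trie

Crux `stmt-CriticalPhenomena-11232`.  Soundness of the computable kit of part 14:

* §5 `block_of_tp2`: for a non-negative array all of whose `2 × 2` minors are non-negative, upper index intervals
  satisfy the four-block inequality `Σ_{I≥t}Σ_J · Σ_I Σ_{J≥t'} ≤ Σ_I Σ_J · Σ_{I≥t}Σ_{J≥t'}` (the finite form of
  "TP₂ ⟹ association of increasing row/column events");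
* §6 `trie_sound` (an accepting trie has run `act` on every class with `≥ 2` members reachable from a member, at
  every depth), `linkedB_pair`, `findOrder_spec`, `tp2OK_spec`, `classOK_spec`, and two counting helpers.

Elementary ("folklore").
-/

namespace Summit.CriticalPhenomena.SAWScalingLimit.Theorems.LeftRightFKG.Negative.PAKit

open Literature.Analysis.ValidatedNumerics
open PolyMP (evalR addR mulR smulR posOn)
open PolyCert (realOf minorI)
open Census (censusList census)

/-! ## §5 The abstract block inequality from `TP₂` (four-block identity) -/

section Matrix

open Finset

/-- **Upper intervals of a `TP₂` array satisfy the block inequality.**  For a non-negative array `M` on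
`[0,p) × [0,q)` all of whose `2 × 2` minors are non-negative, row/column index sets `I ⊆ [0,p)`, `J ⊆ [0,q)` and
thresholds `t`, `t'`: `M(R, J) · M(I, C) ≤ M(I, J) · M(R, C)` for the upper parts `R = I ∩ [t, ∞)`,
`C = J ∩ [t', ∞)` — the four-block identity `M(I,J) M(R,C) − M(R,J) M(I,C) = M(R,C) M(R̄,C̄) − M(R,C̄) M(R̄,C)` and
termwise `TP₂`. [cite: Karlin1968, Ch. 2 §1] -/
theorem block_of_tp2 {p q : ℕ} (M : ℕ → ℕ → ℝ) (h0 : ∀ i j, 0 ≤ M i j)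
    (hTP : ∀ i i' j j', i < i' → i' < p → j < j' → j' < q → M i' j * M i j' ≤ M i' j' * M i j)
    (I J : Finset ℕ) (hI : ∀ i ∈ I, i < p) (hJ : ∀ j ∈ J, j < q) (t t' : ℕ) :
    (∑ i ∈ I.filter (t ≤ ·), ∑ j ∈ J, M i j) * (∑ i ∈ I, ∑ j ∈ J.filter (t' ≤ ·), M i j) ≤
      (∑ i ∈ I, ∑ j ∈ J, M i j) * ∑ i ∈ I.filter (t ≤ ·), ∑ j ∈ J.filter (t' ≤ ·), M i j := by
  classical
  -- the four blocks `R = I ∩ [t,∞)`, `R' = I \ R`, `C = J ∩ [t',∞)`, `C' = J \ C`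
  have hrow : ∀ i, ∑ j ∈ J, M i j = ∑ j ∈ J.filter (t' ≤ ·), M i j + ∑ j ∈ J.filter (fun j => ¬ t' ≤ j), M i j :=
    fun i => (sum_filter_add_sum_filter_not J (t' ≤ ·) (M i)).symm
  have hIsplit : ∀ g : ℕ → ℝ, ∑ i ∈ I, g i = ∑ i ∈ I.filter (t ≤ ·), g i + ∑ i ∈ I.filter (fun i => ¬ t ≤ i), g i :=
    fun g => (sum_filter_add_sum_filter_not I (t ≤ ·) g).symm
  have e1 : ∑ i ∈ I.filter (t ≤ ·), ∑ j ∈ J, M i j = (∑ i ∈ I.filter (t ≤ ·), ∑ j ∈ J.filter (t' ≤ ·), M i j) +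
      ∑ i ∈ I.filter (t ≤ ·), ∑ j ∈ J.filter (fun j => ¬ t' ≤ j), M i j := by
    rw [← sum_add_distrib]; exact sum_congr rfl fun i _ => hrow i
  have e1' : ∑ i ∈ I.filter (fun i => ¬ t ≤ i), ∑ j ∈ J, M i j =
      (∑ i ∈ I.filter (fun i => ¬ t ≤ i), ∑ j ∈ J.filter (t' ≤ ·), M i j) +
      ∑ i ∈ I.filter (fun i => ¬ t ≤ i), ∑ j ∈ J.filter (fun j => ¬ t' ≤ j), M i j := by
    rw [← sum_add_distrib]; exact sum_congr rfl fun i _ => hrow i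
  have e2 := hIsplit fun i => ∑ j ∈ J.filter (t' ≤ ·), M i j
  have e3 : ∑ i ∈ I, ∑ j ∈ J, M i j = _ := (hIsplit fun i => ∑ j ∈ J, M i j).trans (by rw [e1, e1'])
  -- the key block inequality `M(R,C') · M(R',C) ≤ M(R,C) · M(R',C')`, termwise TP₂
  have key : (∑ i ∈ I.filter (t ≤ ·), ∑ j ∈ J.filter (fun j => ¬ t' ≤ j), M i j) *
      (∑ i ∈ I.filter (fun i => ¬ t ≤ i), ∑ j ∈ J.filter (t' ≤ ·), M i j) ≤
      (∑ i ∈ I.filter (t ≤ ·), ∑ j ∈ J.filter (t' ≤ ·), M i j) *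
      ∑ i ∈ I.filter (fun i => ¬ t ≤ i), ∑ j ∈ J.filter (fun j => ¬ t' ≤ j), M i j := by
    rw [sum_mul_sum, sum_mul_sum]
    refine sum_le_sum fun i hi => sum_le_sum fun i' hi' => ?_
    rw [sum_mul_sum, sum_mul_sum]
    conv_lhs => rw [Finset.sum_comm]
    refine sum_le_sum fun j hj => sum_le_sum fun j' hj' => ?_
    simp only [mem_filter] at hi hi' hj hj'
    exact hTP i' i j' j (by omega) (hI i hi.1) (by omega) (hJ j hj.1)
  have h0' : 0 ≤ ∑ i ∈ I.filter (t ≤ ·), ∑ j ∈ J.filter (t' ≤ ·), M i j :=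
    sum_nonneg fun i _ => sum_nonneg fun j _ => h0 i j
  rw [e1, e2, e3]
  nlinarith [key, h0']

end Matrix

/-! ## §6 Soundness of the trie and of the per-class search -/

/-- `agreeOn` unfolds to agreement at positions `k < i ≤ k'`. [folklore] -/
theorem agreeOn_iff (pos : Code → ℕ → ℤ × ℤ) (ce c : Code) (k k' : ℕ) :
    agreeOn pos ce c k k' = true ↔ ∀ i, k < i → i ≤ k' → pos c i = pos ce i := by
  simp only [agreeOn, List.all_eq_true, List.mem_range, decide_eq_true_eq]
  constructor
  · intro h i hi hi'
    have := h (i - (k + 1)) (by omega)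
    rwa [show k + 1 + (i - (k + 1)) = i by omega] at this
  · intro h t ht
    exact h _ (by omega) (by omega)

/-- `agreeOn … k k` is vacuous. [folklore] -/
theorem agreeOn_self (pos : Code → ℕ → ℤ × ℤ) (ce c : Code) (k : ℕ) : agreeOn pos ce c k k = true := by
  simp [agreeOn]

/-- One trie step: agreement on `(k, k']` = agreement at `k + 1` and on `(k+1, k']`. [folklore] -/
theorem agreeOn_succ (pos : Code → ℕ → ℤ × ℤ) (ce c : Code) {k k' : ℕ} (hk : k < k') :
    agreeOn pos ce c k k' = (agreeOn pos ce c (k + 1) k' && decide (pos c (k + 1) = pos ce (k + 1))) := by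
  apply Bool.eq_iff_iff.2
  simp only [Bool.and_eq_true, decide_eq_true_eq, agreeOn_iff]
  constructor
  · intro h
    exact ⟨fun i hi hi' => h i (by omega) hi', h (k + 1) (by omega) hk⟩
  · rintro ⟨h2, h1⟩ i hi hi'
    by_cases he : i = k + 1
    · subst he; exact h1
    · exact h2 i (by omega) hi'

/-- **Soundness of the trie (coverage)**: if the trie accepts `(P, k)` with fuel `f`, then for every `ce ∈ P` and every
depth `k ≤ k' < k + f`, the sub-class of `P` agreeing with `ce` on `(k, k']` — when it has at least two codes — was
visited, i.e. `act` accepts it at `k'`. [folklore] -/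
theorem trie_sound (pos : Code → ℕ → ℤ × ℤ) (act : List Code → ℕ → Bool) :
    ∀ (f : ℕ) (P : List Code) (k : ℕ), trie pos act f P k = true → ∀ ce ∈ P, ∀ k', k ≤ k' → k' < k + f →
      2 ≤ (P.filter fun c => agreeOn pos ce c k k').length →
      act (P.filter fun c => agreeOn pos ce c k k') k' = true := by
  intro f
  induction f with
  | zero => intro P k _ ce _ k' hk hk'; omega
  | succ f ih =>
    intro P k h ce hce k' hk hk' h2
    have hPl : ¬ P.length ≤ 1 := fun hle => by
      have := List.length_filter_le (fun c => agreeOn pos ce c k k') P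
      omega
    have h' : act P k = true ∧ ∀ u ∈ (P.map fun c => pos c (k + 1)).dedup,
        trie pos act f (P.filter fun c => decide (pos c (k + 1) = u)) (k + 1) = true := by
      simpa [trie, hPl, List.all_eq_true] using h
    rcases Nat.eq_or_lt_of_le hk with rfl | hlt
    · have hP : P.filter (fun c => agreeOn pos ce c k k) = P :=
        List.filter_eq_self.2 fun c _ => agreeOn_self pos ce c k
      rw [hP]
      exact h'.1
    · have hu : pos ce (k + 1) ∈ (P.map fun c => pos c (k + 1)).dedup :=
        List.mem_dedup.2 (List.mem_map.2 ⟨ce, hce, rfl⟩)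
      have hce' : ce ∈ P.filter fun c => decide (pos c (k + 1) = pos ce (k + 1)) :=
        List.mem_filter.2 ⟨hce, by simp⟩
      have hfilt : (P.filter fun c => decide (pos c (k + 1) = pos ce (k + 1))).filter
          (fun c => agreeOn pos ce c (k + 1) k') = P.filter fun c => agreeOn pos ce c k k' := by
        rw [List.filter_filter]
        exact List.filter_congr fun c _ => (agreeOn_succ pos ce c hlt).symm
      have key := ih _ (k + 1) (h'.2 _ hu) ce hce' k' hlt (by omega)
      rw [hfilt] at key
      exact key h2

/-- Consecutive entries of a linked list are realised by a comparable pair of codes of `Q`. [folklore] -/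
theorem linkedB_pair {lrC : Code → Code → Bool} {f : Code → ℤ × ℤ} {Q : List Code} :
    ∀ {l : List (ℤ × ℤ)}, linkedB lrC f Q l = true → ∀ (i : ℕ) (h : i + 1 < l.length),
      ∃ c ∈ Q, ∃ c' ∈ Q, f c = l[i] ∧ f c' = l[i + 1] ∧ lrC c c' = true
  | [], _, i, h => by simp at h
  | [u], _, i, h => by simp at h
  | u :: v :: rest, h, i, hi => by
    have h' : (∃ c ∈ Q, f c = u ∧ ∃ c' ∈ Q, f c' = v ∧ lrC c c' = true) ∧ linkedB lrC f Q (v :: rest) = true := by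
      simpa [linkedB, List.any_eq_true, and_assoc] using h
    obtain ⟨⟨c, hc, hcu, c', hc', hc'v, hl⟩, hrest⟩ := h'
    cases i with
    | zero => exact ⟨c, hc, c', hc', by simpa using hcu, by simpa using hc'v, hl⟩
    | succ i =>
      obtain ⟨c, hc, c', hc', h1, h2, h3⟩ := linkedB_pair hrest i (by simpa using hi)
      exact ⟨c, hc, c', hc', by simpa using h1, by simpa using h2, h3⟩

/-- What a successful order search delivers: a linked, duplicate-free list containing every realised direction.
[folklore] -/
theorem findOrder_spec {lrC : Code → Code → Bool} {f : Code → ℤ × ℤ} {Q : List Code} {No : List (ℤ × ℤ)}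
    (h : findOrder lrC f Q = some No) : linkedB lrC f Q No = true ∧ No.Nodup ∧ ∀ c ∈ Q, f c ∈ No := by
  have h1 := List.find?_some h
  have h2 := List.mem_of_find?_eq_some h
  rw [List.mem_permutations] at h2
  exact ⟨h1, h2.nodup_iff.2 (List.nodup_dedup _), fun c hc =>
    h2.mem_iff.2 (List.mem_dedup.2 (List.mem_map.2 ⟨c, hc, rfl⟩))⟩

/-- What `tp2OK` delivers for one pair of rows and columns. [folklore] -/
theorem tp2OK_spec {mOK : List ℤ → List ℤ → List ℤ → List ℤ → Bool} {M : ℕ → ℕ → List ℤ} {p q : ℕ}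
    (h : tp2OK mOK M p q = true) {i i' j j' : ℕ} (hi : i < i') (hi' : i' < p) (hj : j < j') (hj' : j' < q) :
    mOK (M i' j') (M i j) (M i' j) (M i j') = true := by
  simp only [tp2OK, List.all_eq_true, List.mem_range] at h
  exact h i' hi' i hi j' hj' j hj

/-- What `classOK` delivers: the two linked orders and the certified minors. [folklore] -/
theorem classOK_spec {g : Cfg} {Q : List Code} {k m : ℕ} (h : classOK g Q k m = true) :
    ∃ No Wo : List (ℤ × ℤ),
      findOrder (lrCode g.X0 g.X1 g.Y0 g.Y1) (fun c => getV g.bz c (k + 1)) Q = some No ∧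
      findOrder (lrCode g.X0 g.X1 g.Y0 g.Y1) (fun c => getVR g.bz c (m + 1)) Q = some Wo ∧
      tp2OK (minorOK g.S g.dp g.lo g.hi)
        (fun i j => entry (fun c => getV g.bz c (k + 1)) (fun c => getVR g.bz c (m + 1)) Q g.N
          (No.getD i g.bz) (Wo.getD j g.bz)) No.length Wo.length = true := by
  cases h1 : findOrder (lrCode g.X0 g.X1 g.Y0 g.Y1) (fun c => getV g.bz c (k + 1)) Q with
  | none => simp [classOK, h1] at h
  | some No =>
    cases h2 : findOrder (lrCode g.X0 g.X1 g.Y0 g.Y1) (fun c => getVR g.bz c (m + 1)) Q with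
    | none => simp [classOK, h1, h2] at h
    | some Wo =>
      simp only [classOK, h1, h2] at h
      exact ⟨No, Wo, rfl, rfl, h⟩

/-- A duplicate-free list with two distinct members has length `≥ 2`. [folklore] -/
theorem two_le_length {α : Type*} {l : List α} {u v : α} (hu : u ∈ l) (hv : v ∈ l) (huv : u ≠ v) :
    2 ≤ l.length := by
  match l, hu, hv with
  | [w], hu, hv =>
    rw [List.mem_singleton] at hu hv
    exact absurd (hu.trans hv.symm) huv
  | _ :: _ :: _, _, _ => simp

/-- A monotone predicate on `[0, p)` is an upper interval. [folklore] -/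
theorem exists_threshold {P : ℕ → Prop} {p : ℕ} (hmono : ∀ i, i + 1 < p → P i → P (i + 1)) :
    ∃ t, ∀ i, i < p → (P i ↔ t ≤ i) := by
  classical
  by_cases hex : ∃ i, i < p ∧ P i
  · refine ⟨Nat.find hex, fun i hi => ⟨fun hP => Nat.find_min' hex ⟨hi, hP⟩, fun ht => ?_⟩⟩
    obtain ⟨-, h0⟩ := Nat.find_spec hex
    -- climb from the threshold to `i`
    have key : ∀ d, Nat.find hex + d < p → P (Nat.find hex + d) := by
      intro d
      induction d with
      | zero => intro _; simpa using h0
      | succ d ih => intro hd; exact hmono _ (by omega) (ih (by omega))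
    have := key (i - Nat.find hex) (by omega)
    rwa [Nat.add_sub_cancel' ht] at this
  · push Not at hex
    exact ⟨p, fun i hi => ⟨fun hP => absurd hP (hex i hi), fun h => absurd h (by omega)⟩⟩

end Summit.CriticalPhenomena.SAWScalingLimit.Theorems.LeftRightFKG.Negative.PAKit
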